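import Summits.CriticalPhenomena.Ising3DConformalLimit.Theses.FilmLadder
import Literature.Probability.LatticeModels.PointwiseScalingLimitEtaExists
import Literature.Probability.LatticeModels.HighDimPointwiseTriviality
import HarnessLib.Audit.Check

/-!
# Birth skeleton for crux `FilmSaturation` (stmt-CriticalPhenomena-4761), route `FilmLadder`

Crux (B), rank 3 of `route-CriticalPhenomena-FilmLadder` (sub-problem `Ising3DConformalLimit`):
FILM SATURATION AT THE CROSSOVER SCALE for the nearest-neighbour Ising model on `ℤ³` at `β_c(3)`,
`∃ A : ℕ, ∃ c > 0, ∀ n, ∀ x ∈ box 3 n, x 0 = 0 → c·τ(x) ≤ τ_{A·n}(x)`, where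
`τ(x) = ⟨σ₀σ_x⟩⁺_{β_c(3)} = criticalTwoPoint 3 x` and
`τ_m(x) = ⨆_L ⟨σ₀σ_x⟩^free_{[-L,L]³ ∩ {|z₀| ≤ m}; β_c(3)}` is the two-point function of the infinite FILM of
half-thickness `m` with free surfaces, held at the BULK critical point: a film whose thickness is a
fixed multiple of the distance carries a fixed fraction of the bulk critical correlation.

## The line: METHOD OF IMAGES (Camia–Jiang–Newman) + AXIAL DILATION DECAY of the bulk two-point function

This is the glued split foreseen by the two retriage planners of the item (2026-08-15, notes on
stmt-4761: "FilmImageBound (provable now) + BulkDilationDecay (open, distance-regularity type)") and by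
the crux's own `why it might fail` ("CJN2021 eq. (58) adapts to films: τ_{An}(x) ≥ τ(x) − 2τ(x+2An·e₀), so
it follows from … τ halves across a fixed dilation at ALL scales").

* `stub_filmImageBound` (L, PROVABLE from print — the film-side engine): for every half-thickness `m`
  and every mid-plane site `x` (`x 0 = 0`),
  `τ(x) − τ(x + 2m·e₀) − τ(x − 2m·e₀) ≤ τ_m(x)`:
  the film loses at most the bulk correlation of `0` with the two MIRROR IMAGES of `x` in the planes
  `{z₀ = ±m}` containing the free surfaces.  Route of proof = Camia–Jiang–Newman, "The effect of free
  boundary conditions on the Ising model in high dimensions", PTRF 181 (2021), eq. (58) (valid for ALL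
  `β ≥ 0` and all `d`, loc. cit. after (58)): `⟨σ_xσ_y⟩^f_Λ ≥ ⟨σ_xσ_y⟩_{ℤ^d} − Σ_faces ⟨σ_xσ_{y^i}⟩_{ℤ^d}`
  for a box `Λ`, `y^i` the reflection of `y` in the plane containing the `i`-th face — switching lemma
  (their Lemma 1 = ADCS2015 Lemma 2.2), backbone first-hit decomposition at `∂Λ` (their Prop. 1 (a)–(c),
  Aizenman 1982 / Aizenman–Fernández 1986) and the folded-GKS reflection inequality
  `⟨σ_uσ_y⟩_{D∖Ā} ≥ ⟨σ_uσ_{ȳ}⟩_{D∖Ā}` for `u` on the mirror plane (their Prop. 2; cf. the in-tree free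
  Messager–Miracle-Solé folding `messager_miracleSole_free`).  Applied to the film boxes
  `[-L,L]³ ∩ {|z₀| ≤ m}` (faces `z₀ = ±m` and four lateral faces at distance `≥ 2L − ‖x‖`), the four
  lateral image terms vanish as `L → ∞` (`τ(y) ≤ C/‖y‖`, `criticalTwoPoint_bounds_holds`) and the `⨆_L`
  keeps the two surface images; `⟨·⟩_{ℤ³}` (free infinite-volume state) `= ⟨·⟩⁺` at `β_c`
  (`twoPointPlus_criticalBeta_eq_twoPointFree_holds`).  The case `m = 0` is the trivial `−τ(x) ≤ τ_0(x)`.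
* `stub_axialDilationDecay` (OPEN — THE LOAD-BEARING STUB): `∃ A ≥ 1, ∃ θ < 1, ∀ r ≥ 1,
  τ(A·r·e₀) ≤ θ·τ(r·e₀)` — the bulk critical AXIS two-point function (antitone in `r` by
  Messager–Miracle-Solé, `criticalTwoPoint_axis_antitone`) decays by a uniform factor across ONE fixed
  dilation, at every scale; equivalently (iterate) `τ(A^k r e₀) ≤ θ^k τ(r e₀)`, i.e. the upper Matuszewska
  index of `r ↦ τ(r e₀)` is negative (`τ(λr e₀)/τ(r e₀) ≤ C λ^{−α}`, some `α > 0`).  True in the expected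
  world (`τ(r e₀) ≍ r^{−(1+η)}`, `θ = A^{−(1+η)}`); implied by the dyadic scaling law of route
  ThresholdDilation and by all-scale ADC21 regularity; NOT implied by the rigorous window
  `c/r² ≤ τ ≤ C/r` (a plateau of τ over `[r, A r]` at sparse scales is compatible with it) — this is the
  distance-regularity content the crux's why-it-might-fail names (ADC21 Thm 4.13 gives such decay only on
  a positive fraction of dyadic scales).  Why easier than the crux: a ONE-dimensional statement about a
  positive antitone sequence in the bulk `+` state (RP, spectral/Källén–Lehmann representations along an
  axis, DCP 2025 gradient estimates all apply), with no film, no boundary condition and no uniformity in a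
  second parameter.
* `FilmSaturation_of` (REAL PROOF, this file): iterate the decay stub to a factor `1/4` (`B = A^k`,
  `θ^k ≤ 1/4`), take film half-thickness `m = 2B·n` (crux witness `A_crux = 2B`, `c = 1/2`); for a
  mid-plane `x ≠ 0` in `box 3 n` the MMS sphere sandwich (`criticalTwoPoint_axis_sandwich`) gives
  `τ(x) ≥ τ(3n e₀)` and `τ(x ± 2m e₀) ≤ τ(4Bn e₀) ≤ τ(3Bn e₀) ≤ τ(3n e₀)/4`, so the image bound yields
  `τ_m(x) ≥ τ(x) − τ(x)/2`; `x = 0` is `1/2 ≤ 1 = τ_m(0)`.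

Neither stub is cheaply the crux or the summit: `stub_filmImageBound` is a lower bound with an error
term that the rigorous window cannot absorb (`2τ(2m e₀) ≤ 2C/(2An)` vs `τ(x) ≥ c/n²`), and
`stub_axialDilationDecay` speaks of the bulk axis function only (no film quantity occurs in it); BC3
probes (`stub → FilmSaturation`, `stub → Ising3DConformalLimit` by
`first | exact? | simpa [C] | (unfold C; simpa) | aesop`) are recorded in the planner folder
(`bc/FilmSaturation_probe.lean`) and in `BC3-birth.md` on the crux.

Disproof used: none on file (`ledger crux ls stmt-CriticalPhenomena-4761`: no workfiles, no
`Disproof.lean`, no `Theorems/FilmSaturation/Negative/`).  Negatives index (`ledger negatives --problem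
CriticalPhenomena`, 2026-08-17: 11 refuted statements, all in CardyFormulaZ2 / PercolationContinuityZ3 /
SAWScalingLimit): none concerns `criticalTwoPoint 3`, films or free-boundary two-point functions.
-/

noncomputable section

namespace Summit.CriticalPhenomena.Ising3DConformalLimit.Cruxes.FilmSaturation.Birth

open scoped BigOperators Topology Classical
open Filter Set Function
open Literature.Probability.LatticeModels

/-! ## The two registered stubs (signatures fully qualified, over importable vocabulary only) -/

/-- **STUB 1 · `stub_filmImageBound` (L, provable from print) — method of images for the critical film.**
For every half-thickness `m : ℕ` and every mid-plane site `x` (`x 0 = 0`):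
`τ(x) − τ(x + 2m e₀) − τ(x − 2m e₀) ≤ τ_m(x) := ⨆_L ⟨σ₀σ_x⟩^free_{box 3 L ∩ {|z 0| ≤ m}; β_c(3)}`.
Camia–Jiang–Newman 2021 eq. (58) (all `β`, all `d`; switching lemma + backbone first-hit decomposition +
folded-GKS reflection inequality Prop. 2) applied to the film boxes, lateral images → 0 as `L → ∞` by
`criticalTwoPoint_bounds_holds`, free = plus at `β_c` by `twoPointPlus_criticalBeta_eq_twoPointFree_holds`.
[CamiaJiangNewman2021 eq. (58), Prop. 2; AizenmanDuminilCopinSidoravicius2015 Lemma 2.2; Aizenman1982;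
in tree: messager_miracleSole_free, criticalTwoPoint_bounds_holds, isingCorr_free_mono_volume_of_gks] -/
theorem stub_filmImageBound :
    ∀ (m : ℕ) (x : Literature.Probability.LatticeModels.Site 3), x 0 = 0 →
      Literature.Probability.LatticeModels.criticalTwoPoint 3 x
          - Literature.Probability.LatticeModels.criticalTwoPoint 3 (x + Pi.single 0 ((2 * m : ℕ) : ℤ))
          - Literature.Probability.LatticeModels.criticalTwoPoint 3 (x - Pi.single 0 ((2 * m : ℕ) : ℤ)) ≤
        (⨆ L : ℕ, Literature.Probability.LatticeModels.isingTwoPoint (Literature.Probability.LatticeModels.zdGraph 3)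
          ((Literature.Probability.LatticeModels.box 3 L).filter (fun z => |z 0| ≤ ((m : ℕ) : ℤ)))
          (Literature.Probability.LatticeModels.criticalBeta 3) 0
          Literature.Probability.LatticeModels.BoundaryCondition.free 0 x) := by
  sorry

/-- **STUB 2 · `stub_axialDilationDecay` (OPEN — load-bearing) — uniform decay of the bulk critical axis
two-point function across one fixed dilation, at every scale.**
`∃ A ≥ 1, ∃ θ < 1, ∀ r ≥ 1, τ(A r e₀) ≤ θ τ(r e₀)` with `τ(r e₀) = criticalTwoPoint 3 (Pi.single 0 r)`
(any witness has `A ≥ 2` and `θ > 0` by positivity).  Equivalent to a negative upper Matuszewska index of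
the antitone sequence `r ↦ τ(r e₀)`; implied by the dyadic scaling law / all-scale ADC21 regularity; open:
the rigorous window `c r⁻² ≤ τ(r e₀) ≤ C r⁻¹` allows plateaus over `[r, A r]` at sparse scales.
[AizenmanDuminilCopinAnnals2021 Thm 4.13 and §5.6; DuminilcopinPanis2025 Thm 1.2–1.5 (arXiv:2404.05700);
DuminilCopinICM2022 §4.2.1, §8.4; MessagerMiracleSoleJSP1977; in tree: criticalTwoPoint_axis_antitone,
criticalTwoPoint_bounds_holds, dcp_criticalTwoPoint_axis_lower_holds] -/
theorem stub_axialDilationDecay :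
    ∃ A : ℕ, 1 ≤ A ∧ ∃ θ : ℝ, θ < 1 ∧ ∀ r : ℕ, 1 ≤ r →
      Literature.Probability.LatticeModels.criticalTwoPoint 3 (Pi.single 0 ((A * r : ℕ) : ℤ)) ≤
        θ * Literature.Probability.LatticeModels.criticalTwoPoint 3 (Pi.single 0 (r : ℤ)) := by
  sorry

/-! ## Names for the statements (hypotheses of the composition)

The layer-invariant audit admits, as hypotheses of the theorem that concludes the crux, only registered
obligations or the declared stubs BY NAME; `Statement.stub_x` is the statement of `stub_x` (its `type_of%`). -/

namespace Statement

/-- Statement of `stub_filmImageBound`. -/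
abbrev stub_filmImageBound : Prop := type_of% Birth.stub_filmImageBound
/-- Statement of `stub_axialDilationDecay`. -/
abbrev stub_axialDilationDecay : Prop := type_of% Birth.stub_axialDilationDecay

end Statement

/-! ## Local shorthand (verbatim sub-terms of the route decl), certified by `Iff.rfl` -/

/-- `τ(x) = ⟨σ₀σ_x⟩⁺_{β_c(3)}`. -/
def τ (x : Site 3) : ℝ := Literature.Probability.LatticeModels.criticalTwoPoint 3 x

/-- `g(m) = τ(m e₀)` for a natural axis coordinate `m`. -/
def g (m : ℕ) : ℝ := Literature.Probability.LatticeModels.criticalTwoPoint 3 (Pi.single 0 (m : ℤ))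

/-- `τ_m(x)`: the two-point function `⟨σ₀σ_x⟩` of the infinite film of half-thickness `m` with free
surfaces at `β_c(3)` (sup over the lateral size `L` of the free-b.c. film boxes). -/
def filmTP (m : ℕ) (x : Site 3) : ℝ :=
  ⨆ L : ℕ, Literature.Probability.LatticeModels.isingTwoPoint (Literature.Probability.LatticeModels.zdGraph 3)
    ((Literature.Probability.LatticeModels.box 3 L).filter (fun z => |z 0| ≤ ((m : ℕ) : ℤ)))
    (Literature.Probability.LatticeModels.criticalBeta 3) 0
    Literature.Probability.LatticeModels.BoundaryCondition.free 0 x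

/-- The crux, read through `τ` and `filmTP`. -/
theorem crux_iff :
    Summit.CriticalPhenomena.Ising3DConformalLimit.Theses.FilmLadder.FilmSaturation ↔
      ∃ A : ℕ, ∃ c : ℝ, 0 < c ∧ ∀ n : ℕ, ∀ x ∈ box 3 n, x 0 = 0 → c * τ x ≤ filmTP (A * n) x :=
  Iff.rfl

/-- `stub_filmImageBound`, read through `τ` and `filmTP`. -/
theorem stub_filmImageBound_iff :
    Statement.stub_filmImageBound ↔
      ∀ (m : ℕ) (x : Site 3), x 0 = 0 →
        τ x - τ (x + Pi.single 0 ((2 * m : ℕ) : ℤ)) - τ (x - Pi.single 0 ((2 * m : ℕ) : ℤ)) ≤ filmTP m x :=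
  Iff.rfl

/-- `stub_axialDilationDecay`, read through `g`. -/
theorem stub_axialDilationDecay_iff :
    Statement.stub_axialDilationDecay ↔
      ∃ A : ℕ, 1 ≤ A ∧ ∃ θ : ℝ, θ < 1 ∧ ∀ r : ℕ, 1 ≤ r → g (A * r) ≤ θ * g r :=
  Iff.rfl

/-! ## Bulk facts used by the composition (all proved in tree: MMS axis/sphere comparisons, positivity) -/

/-- `g` is antitone (Messager–Miracle-Solé along the axis; tree `criticalTwoPoint_axis_antitone`). -/
theorem g_antitone {a b : ℕ} (h : a ≤ b) : g b ≤ g a :=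
  criticalTwoPoint_axis_antitone h

/-- `g > 0` (tree `criticalTwoPoint_axis_pos`). -/
theorem g_pos (m : ℕ) : 0 < g m :=
  criticalTwoPoint_axis_pos m

/-- `τ(0) = 1`. -/
theorem τ_zero : τ 0 = 1 :=
  criticalTwoPoint_zero'

/-- Lower MMS sphere bound: for `x ≠ 0` in `box 3 n`, `τ(3n e₀) ≤ τ(x)` (sandwich at `‖x‖∞ ≤ n`). -/
theorem g_three_mul_le_τ {n : ℕ} {x : Site 3} (hx : x ∈ box 3 n) (hx0 : x ≠ 0) : g (3 * n) ≤ τ x := by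
  have h1 : 1 ≤ Site.supNorm x := by
    rcases Nat.eq_zero_or_pos (Site.supNorm x) with h | h
    · exact absurd (Site.supNorm_eq_zero_iff.1 h) hx0
    · exact h
  have hn : Site.supNorm x ≤ n := by
    rw [Site.supNorm_le_iff]
    intro i
    have hi := (mem_box.1 hx) i
    omega
  calc g (3 * n) ≤ g (3 * Site.supNorm x) := g_antitone (by omega)
    _ ≤ τ x := (criticalTwoPoint_axis_sandwich h1).1

/-- Upper MMS sphere bound: if `|y 0| ≥ M ≥ 1` then `τ(y) ≤ τ(M e₀)`. -/
theorem τ_le_g_of_le_natAbs {y : Site 3} {M : ℕ} (hM : 1 ≤ M) (hy : M ≤ (y 0).natAbs) : τ y ≤ g M := by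
  have h1 : M ≤ Site.supNorm y := hy.trans (Site.natAbs_le_supNorm y 0)
  calc τ y ≤ g (Site.supNorm y) := (criticalTwoPoint_axis_sandwich (hM.trans h1)).2
    _ ≤ g M := g_antitone h1

/-- Iterating the dilation decay: `τ(A^k r e₀) ≤ θ^k τ(r e₀)`. -/
theorem iterate_decay {A : ℕ} (hA : 1 ≤ A) {θ : ℝ} (hθ : 0 ≤ θ)
    (h : ∀ r : ℕ, 1 ≤ r → g (A * r) ≤ θ * g r) :
    ∀ k r : ℕ, 1 ≤ r → g (A ^ k * r) ≤ θ ^ k * g r := by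
  intro k
  induction k with
  | zero =>
      intro r _
      simp
  | succ k ih =>
      intro r hr
      have hA0 : 0 < A := hA
      have hr0 : 0 < r := hr
      have hr' : 1 ≤ A ^ k * r := Nat.succ_le_of_lt (by positivity)
      calc g (A ^ (k + 1) * r) = g (A * (A ^ k * r)) := by rw [pow_succ', mul_assoc]
        _ ≤ θ * g (A ^ k * r) := h _ hr'
        _ ≤ θ * (θ ^ k * g r) := mul_le_mul_of_nonneg_left (ih r hr) hθ
        _ = θ ^ (k + 1) * g r := by ring

/-- From the decay stub: some dilation `B ≥ 1` quarters the axis function at every scale. -/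
theorem exists_quarter_decay (h₂ : Statement.stub_axialDilationDecay) :
    ∃ B : ℕ, 1 ≤ B ∧ ∀ r : ℕ, 1 ≤ r → g (B * r) ≤ g r / 4 := by
  rw [stub_axialDilationDecay_iff] at h₂
  obtain ⟨A, hA, θ, hθ1, h⟩ := h₂
  have hθ0 : 0 < θ := by
    have h1 := h 1 le_rfl
    have hp : 0 < g (A * 1) := g_pos _
    have hq : 0 < g 1 := g_pos _
    nlinarith
  obtain ⟨k, hk⟩ := exists_pow_lt_of_lt_one (show (0 : ℝ) < 1 / 4 by norm_num) hθ1
  refine ⟨A ^ k, Nat.one_le_pow _ _ hA, fun r hr => ?_⟩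
  have hit := iterate_decay hA hθ0.le h k r hr
  have hg : 0 ≤ g r := (g_pos r).le
  calc g (A ^ k * r) ≤ θ ^ k * g r := hit
    _ ≤ (1 / 4) * g r := mul_le_mul_of_nonneg_right hk.le hg
    _ = g r / 4 := by ring

/-- The film two-point function on the diagonal: `τ_m(0) = 1`. -/
theorem filmTP_zero (m : ℕ) : filmTP m 0 = 1 := by
  simp [filmTP]

/-! ## The composition (kernel-checked, no sorry): the two stubs give the crux BY NAME -/

/-- **`FilmSaturation` from the stubs.**  Quarter the axis function across a dilation `B` (decay stub,
iterated), take film half-thickness `m = 2B·n` and `c = 1/2`: for a mid-plane `x ≠ 0` in `box 3 n`,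
`τ(x ± 2m e₀) ≤ τ(4Bn e₀) ≤ τ(3Bn e₀) ≤ τ(3n e₀)/4 ≤ τ(x)/4` (MMS sandwich), so the image bound gives
`τ_m(x) ≥ τ(x)/2`; at `x = 0`, `τ_m(0) = 1 ≥ 1/2`. -/
theorem FilmSaturation_of (h₁ : Statement.stub_filmImageBound) (h₂ : Statement.stub_axialDilationDecay) :
    Summit.CriticalPhenomena.Ising3DConformalLimit.Theses.FilmLadder.FilmSaturation := by
  rw [crux_iff]
  rw [stub_filmImageBound_iff] at h₁
  obtain ⟨B, hB, hquarter⟩ := exists_quarter_decay h₂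
  refine ⟨2 * B, 1 / 2, by norm_num, fun n x hx hx0 => ?_⟩
  by_cases hxz : x = 0
  · subst hxz
    rw [τ_zero, filmTP_zero]
    norm_num
  · -- the scale is at least one
    have hn : 1 ≤ n := by
      rcases Nat.eq_zero_or_pos n with rfl | hpos
      · exfalso
        apply hxz
        funext i
        have hi := (mem_box.1 hx) i
        simp only [Nat.cast_zero, neg_zero] at hi
        show x i = 0
        exact le_antisymm hi.2 hi.1
      · exact hpos
    have hB0 : 0 < B := hB
    have hn0 : 0 < n := hn
    -- bulk comparisons
    have hlow : g (3 * n) ≤ τ x := g_three_mul_le_τ hx hxz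
    have hq : g (B * (3 * n)) ≤ g (3 * n) / 4 := hquarter (3 * n) (by omega)
    have hM : 1 ≤ 2 * (2 * B * n) := Nat.succ_le_of_lt (by positivity)
    have hB3 : B * (3 * n) ≤ 2 * (2 * B * n) := by nlinarith
    -- the two mirror images of `x`
    have himg := h₁ (2 * B * n) x hx0
    set e : Site 3 := Pi.single 0 ((2 * (2 * B * n) : ℕ) : ℤ) with he
    have hxe : (x + e) 0 = ((2 * (2 * B * n) : ℕ) : ℤ) := by
      simp only [he, Pi.add_apply, hx0, Pi.single_eq_same, zero_add]
    have hxe' : (x - e) 0 = -(((2 * (2 * B * n) : ℕ) : ℤ)) := by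
      simp only [he, Pi.sub_apply, hx0, Pi.single_eq_same, zero_sub]
    have h0p : 2 * (2 * B * n) ≤ ((x + e) 0).natAbs := by
      rw [hxe, Int.natAbs_natCast]
    have h0m : 2 * (2 * B * n) ≤ ((x - e) 0).natAbs := by
      rw [hxe', Int.natAbs_neg, Int.natAbs_natCast]
    have hp : τ (x + e) ≤ g (3 * n) / 4 :=
      calc τ (x + e) ≤ g (2 * (2 * B * n)) := τ_le_g_of_le_natAbs hM h0p
        _ ≤ g (B * (3 * n)) := g_antitone hB3
        _ ≤ g (3 * n) / 4 := hq
    have hm : τ (x - e) ≤ g (3 * n) / 4 :=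
      calc τ (x - e) ≤ g (2 * (2 * B * n)) := τ_le_g_of_le_natAbs hM h0m
        _ ≤ g (B * (3 * n)) := g_antitone hB3
        _ ≤ g (3 * n) / 4 := hq
    -- conclude with the image bound
    calc 1 / 2 * τ x ≤ τ x - τ (x + e) - τ (x - e) := by linarith
      _ ≤ filmTP (2 * B * n) x := himg

end Summit.CriticalPhenomena.Ising3DConformalLimit.Cruxes.FilmSaturation.Birth

end
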